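import Mathlib.Algebra.Field.GeomSum
import Mathlib.Algebra.Field.ZMod
import Mathlib.Algebra.BigOperators.Group.Finset.Sigma
import Mathlib.GroupTheory.Subgroup.Centralizer
import Summits.MatrixMultiplication.OmegaCensus.RCycLift
import Summits.MatrixMultiplication.OmegaCensus.BoxUsefulAtomConfig
import Summits.MatrixMultiplication.OmegaCensus.BoxUsefulDihedral

/-!
# ω-census, family (b3): conjecture C9 (b) — the rank-one Frobenius bridge for every prime `q`, and `AtomBad p q` for `p ≡ 1 (mod q)` from one model family

HONEST FRAMING (pub-omega census; verbatim): lottery ticket; floor = certified bounds/negative ranges.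
Census BOOKKEEPING (conjecture C9 of the cell, STRUCTURE.md §2, `BoxRatioSectionLaw`; pub-omega kernel-l4 gen 17, task K-5″).
Nothing here is progress on `ω`.

After `BoxRatioSectionLawAtoms` / `BoxBadAtomsSmallQ`, C9 (b) on all finite solvable groups needs only `AtomBad p q` for primes
`q ≥ 5`.  This file turns the cell's CONCRETE Frobenius models `MetaCyc p q v = ℤ/p ⋊_v ℤ/q` (stpp-1's certificates, e.g.
`MetaCyc 41 5 10`, `MetaCyc 29 7 7`, `MetaCyc 23 11 2`, …) into the relation-form hypothesis whenever `p ≡ 1 (mod q)`: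
* `not_boxUseful_of_frobenius` — RANK-ONE BRIDGE for any prime `q`: `a` of prime order `p`, `y a y⁻¹ = a^v` with `v^q = 1 ≠ v`
  in `ZMod p`, and `ℤ/p ⋊_v ℤ/q` box-useless ⇒ `G` box-useless (embed `ℤ/p ⋊_v ℤ/|y|` by `RCyc.lift`, reduce onto `ℤ/q`).
* `DFT.exists_eigen` — DISCRETE FOURIER TRANSFORM in a commutative group: if `c₀, c₁, …` (period `q`, exponent `p`) are permuted
  cyclically by an endomorphism `φ`, `∏_{i<q} cᵢ = 1`, `c₀ ≠ 1`, and `u ∈ ZMod p` is a non-trivial `q`-th root of unity, then some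
  `a_j = ∏ᵢ cᵢ^{u^{-ij}}` (`0 < j < q`) is a non-trivial `φ`-EIGENVECTOR: `φ(a_j) = a_j^{u^j}` (the trace condition kills `j = 0`,
  and `∏_j a_j = c₀^q ≠ 1`).
* **`atomBad_of_frobenius_models`** — for primes `p ≠ q` with a non-trivial `q`-th root of unity `u` mod `p` (i.e. `q ∣ p − 1`):
  if `ℤ/p ⋊_v ℤ/q` is box-useless for every such root `v`, then `AtomBad p q` (every `A(p,q)`-configuration is box-useless).
So for `p ≡ 1 (mod q)` the atom hypothesis is ONE model family; for `p ≢ 1 (mod q)` (module rank `k = ord_q p > 1`) the model is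
`𝔽_{p^k} ⋊ μ_q` and no bridge is given here.
-/

namespace Summit.MatrixMultiplication.OmegaCensus

open KeyLift Finset

universe u

variable {G : Type*} [Group G] [Fintype G] [DecidableEq G]

/-- **Rank-one Frobenius bridge, any prime `q`.** `a` of prime order `p`, some `y` (of any order) with `y a y⁻¹ = a^v`,
`v^q = 1`, `v ≠ 1` in `ZMod p`, and `ℤ/p ⋊_v ℤ/q` box-useless ⇒ `G` is box-useless. [folklore] -/
theorem not_boxUseful_of_frobenius {a y : G} {p q : ℕ} [Fact p.Prime] [Fact q.Prime] (ha : orderOf a = p)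
    (v : ZMod p) [hvq : Fact (v ^ q = 1)] (hv1 : v ≠ 1) (hy : y * a * y⁻¹ = a ^ v.val)
    (hbad : ¬ BoxUseful (MetaCyc p q v)) : ¬ BoxUseful G := by
  classical
  have hp : p.Prime := Fact.out
  have hv : v ^ q = 1 := hvq.out
  have hap : a ^ p = 1 := by rw [← ha]; exact pow_orderOf_eq_one a
  haveI : NeZero (orderOf y) := ⟨(orderOf_pos y).ne'⟩
  let e : Multiplicative (ZMod p) →* G := cycHom p a hap
  have he : Function.Injective e := cycHom_injective p a hap ha
  have hy' : ∀ r : ZMod p, y * e (Multiplicative.ofAdd r) * y⁻¹ = e (Multiplicative.ofAdd (v * r)) := by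
    intro r
    change y * a ^ r.val * y⁻¹ = a ^ (v * r).val
    rw [← MulAut.conj_apply, map_pow, MulAut.conj_apply, hy, ← pow_mul, ZMod.val_mul, pow_mod_eq_of_pow_eq_one hap]
  haveI hfact : Fact (v ^ orderOf y = 1) := ⟨RCyc.pow_orderOf_smul_eq e he y hy'⟩
  have hyn : y ^ orderOf y = 1 := pow_orderOf_eq_one y
  have hinj : Function.Injective (RCyc.lift e y hyn hy') := by
    refine RCyc.lift_injective e y hyn hy' he fun t r htr => ?_
    have hc : y * y ^ t.val * y⁻¹ = y ^ t.val := by group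
    rw [htr, hy' r] at hc
    have hr : v * r = r := Multiplicative.ofAdd.injective (he hc)
    have hr0 : r = 0 := by
      have : (v - 1) * r = 0 := by linear_combination hr
      rcases mul_eq_zero.1 this with h | h
      · exact absurd (sub_eq_zero.1 h) hv1
      · exact h
    have hyt : y ^ t.val = 1 := by
      rw [htr, hr0]; change a ^ (0 : ZMod p).val = 1; rw [ZMod.val_zero, pow_zero]
    have ht : orderOf y ∣ t.val := orderOf_dvd_of_pow_eq_one hyt
    exact (ZMod.val_eq_zero t).1 (Nat.eq_zero_of_dvd_of_lt ht (ZMod.val_lt t))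
  have hqn : q ∣ orderOf y := by
    rw [← orderOf_eq_prime hv hv1]
    exact orderOf_dvd_of_pow_eq_one hfact.out
  have hF : ¬ BoxUseful (RCyc (ZMod p) q v) :=
    not_boxUseful_of_injective' (MetaCyc.toRCyc p q v) (MetaCyc.toRCyc_injective p q v) hbad
  have hM : ¬ BoxUseful (RCyc (ZMod p) (orderOf y) v) :=
    not_boxUseful_of_surjective' (RCyc.redHom hqn) (RCyc.redHom_surjective hqn) hF
  exact not_boxUseful_of_injective' _ hinj hM

/-! ### The discrete Fourier transform in a commutative group of exponent `p` -/

namespace DFT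

variable {A : Type*} [CommGroup A] {p q : ℕ}

/-- Powers of an element of exponent `p` depend only on the exponent mod `p`. [folklore] -/
theorem pow_congr_mod {c : A} (hc : c ^ p = 1) {m m' : ℕ} (h : (m : ZMod p) = m') : c ^ m = c ^ m' := by
  rw [ZMod.natCast_eq_natCast_iff'] at h
  rw [← pow_mod_eq_of_pow_eq_one hc m, ← pow_mod_eq_of_pow_eq_one hc m', h]

/-- **DFT eigenvector extraction.**  In a commutative group let `c : ℕ → A` have period `q` and exponent `p` (`p ≠ q` primes),
let `φ` be an endomorphism with `φ(cᵢ) = cᵢ₊₁`, and suppose `∏_{i<q} cᵢ = 1` but `c₀ ≠ 1`.  If `u` is a non-trivial `q`-th root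
of unity in `ZMod p`, then some `g = ∏ᵢ cᵢ^{u^{-ij}}` with `0 < j < q` is a non-trivial `φ`-eigenvector of exponent `p`:
`φ g = g^{u^j}`, `u^j` again a non-trivial `q`-th root of unity. [folklore] -/
theorem exists_eigen [Fact p.Prime] [Fact q.Prime] (hpq : p ≠ q) (c : ℕ → A) (hcq : ∀ i, c (i + q) = c i)
    (hcp : ∀ i, c i ^ p = 1) (φ : A →* A) (hφ : ∀ i, φ (c i) = c (i + 1)) (u : ZMod p) (hu : u ^ q = 1) (hu1 : u ≠ 1)
    (h0 : c 0 ≠ 1) (htr : ∏ i ∈ range q, c i = 1) :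
    ∃ (g : A) (v : ZMod p), g ≠ 1 ∧ g ^ p = 1 ∧ v ^ q = 1 ∧ v ≠ 1 ∧ φ g = g ^ v.val := by
  have hp : p.Prime := Fact.out
  have hq : q.Prime := Fact.out
  have hu0 : u ≠ 0 := by rintro rfl; rw [zero_pow hq.ne_zero] at hu; exact zero_ne_one hu
  set w : ZMod p := u⁻¹ with hw
  have hwu : w * u = 1 := by rw [hw]; exact inv_mul_cancel₀ hu0
  have hwq : w ^ q = 1 := by rw [hw, inv_pow, hu, inv_one]
  have hw1 : w ≠ 1 := fun h => hu1 (by rw [← inv_inv u, ← hw, h, inv_one])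
  have hwo : orderOf w = q := orderOf_eq_prime hwq hw1
  have huo : orderOf u = q := orderOf_eq_prime hu hu1
  -- exponents and the transforms
  let e : ℕ → ℕ → ℕ := fun i j => (w ^ (i * j)).val
  let T : ℕ → A := fun j => ∏ i ∈ range q, c i ^ e i j
  have he : ∀ i j, ((e i j : ℕ) : ZMod p) = w ^ (i * j) := fun i j => ZMod.natCast_zmod_val _
  -- (1) eigenvector property
  have h1 : ∀ j, φ (T j) = T j ^ (u ^ j).val := by
    intro j
    obtain ⟨n, hn⟩ : ∃ n, q = n + 1 := ⟨q - 1, (Nat.succ_pred_eq_of_pos hq.pos).symm⟩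
    have lhs : φ (T j) = ∏ i ∈ range q, c (i + 1) ^ e i j := by
      change φ (∏ i ∈ range q, c i ^ e i j) = _
      rw [map_prod]
      exact prod_congr rfl fun i _ => by rw [map_pow, hφ]
    have rhs : T j ^ (u ^ j).val = ∏ i ∈ range q, c i ^ (e i j * (u ^ j).val) := by
      change (∏ i ∈ range q, c i ^ e i j) ^ _ = _
      rw [← prod_pow]
      exact prod_congr rfl fun i _ => by rw [← pow_mul]
    rw [lhs, rhs, hn, prod_range_succ, prod_range_succ']
    congr 1
    · refine prod_congr rfl fun i _ => pow_congr_mod (hcp _) ?_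
      rw [he, Nat.cast_mul, he, ZMod.natCast_zmod_val]
      calc w ^ (i * j) = w ^ (i * j) * (w * u) ^ j := by rw [hwu, one_pow, mul_one]
        _ = w ^ ((i + 1) * j) * u ^ j := by ring
    · have hc0 : c (n + 1) = c 0 := by rw [← hn, ← zero_add q, hcq 0]
      rw [hc0]
      refine pow_congr_mod (hcp _) ?_
      rw [he, Nat.cast_mul, he, ZMod.natCast_zmod_val, zero_mul, pow_zero, one_mul]
      have hq' : w ^ (n * j) * w ^ j = 1 := by
        rw [← pow_add, show n * j + j = (n + 1) * j by ring, ← hn, pow_mul, hwq, one_pow]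
      have hu' : u ^ j * w ^ j = 1 := by rw [← mul_pow, mul_comm, hwu, one_pow]
      calc w ^ (n * j) = w ^ (n * j) * (u ^ j * w ^ j) := by rw [hu', mul_one]
        _ = u ^ j * (w ^ (n * j) * w ^ j) := by ring
        _ = u ^ j := by rw [hq', mul_one]
  -- (2) the product of all transforms is `c 0 ^ q`
  have h2 : ∏ j ∈ range q, T j = c 0 ^ q := by
    change ∏ j ∈ range q, ∏ i ∈ range q, c i ^ e i j = _
    rw [prod_comm]
    simp_rw [prod_pow_eq_pow_sum]
    rw [prod_eq_single_of_mem 0 (mem_range.2 hq.pos)]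
    · congr 1
      change ∑ j ∈ range q, (w ^ (0 * j)).val = q
      simp [ZMod.val_one]
    · intro i hi hi0
      refine (pow_congr_mod (hcp i) ?_).trans (pow_zero (c i))
      rw [Nat.cast_sum, Nat.cast_zero]
      simp_rw [he]
      have hx1 : w ^ i ≠ 1 := by
        intro hx
        have hdvd : q ∣ i := by rw [← hwo]; exact orderOf_dvd_of_pow_eq_one hx
        have := Nat.le_of_dvd (Nat.pos_of_ne_zero hi0) hdvd
        exact absurd (mem_range.1 hi) (by omega)
      calc ∑ j ∈ range q, w ^ (i * j) = ∑ j ∈ range q, (w ^ i) ^ j := by simp_rw [pow_mul]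
        _ = ((w ^ i) ^ q - 1) / (w ^ i - 1) := geom_sum_eq hx1 q
        _ = 0 := by rw [← pow_mul, mul_comm, pow_mul, hwq, one_pow, sub_self, zero_div]
  -- (3) some transform with `j ≠ 0` is non-trivial
  have hT0 : T 0 = 1 := by
    change ∏ i ∈ range q, c i ^ e i 0 = 1
    rw [← htr]
    exact prod_congr rfl fun i _ => by simp [e, ZMod.val_one]
  obtain ⟨j, hj, hTj⟩ : ∃ j ∈ range q, T j ≠ 1 := by
    by_contra! hall
    have : c 0 ^ q = 1 := by rw [← h2]; exact prod_eq_one hall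
    have hg : c 0 ^ Nat.gcd q p = 1 := pow_gcd_eq_one.2 ⟨this, hcp 0⟩
    rw [(Nat.coprime_primes hq hp).2 (Ne.symm hpq), pow_one] at hg
    exact h0 hg
  have hj0 : j ≠ 0 := by rintro rfl; exact hTj hT0
  refine ⟨T j, u ^ j, hTj, ?_, ?_, ?_, h1 j⟩
  · change (∏ i ∈ range q, c i ^ e i j) ^ p = 1
    rw [← prod_pow]
    exact prod_eq_one fun i _ => by rw [← pow_mul, mul_comm, pow_mul, hcp, one_pow]
  · rw [← pow_mul, mul_comm, pow_mul, hu, one_pow]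
  · intro h
    have hdvd : q ∣ j := by rw [← huo]; exact orderOf_dvd_of_pow_eq_one h
    have := Nat.le_of_dvd (Nat.pos_of_ne_zero hj0) hdvd
    exact absurd (mem_range.1 hj) (by omega)

end DFT

/-! ### `AtomBad p q` from the Frobenius models, `p ≡ 1 (mod q)` -/

/-- **An `A(p,q)`-configuration with a `q`-th root of unity mod `p` contains a rank-one Frobenius configuration.**  From
`AtomConfig p q a y` (`p ≠ q` primes) and a non-trivial `q`-th root of unity `u ∈ ZMod p`: some element `g ≠ 1` of exponent `p`
(a DFT combination of the conjugates `yⁱ a y⁻ⁱ`) satisfies `y g y⁻¹ = g^v` with `v^q = 1 ≠ v`. [folklore] -/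
theorem AtomConfig.exists_frobenius {H : Type*} [Group H] {p q : ℕ} {a y : H} (hp : p.Prime) (hq : q.Prime) (hpq : p ≠ q)
    (h : AtomConfig p q a y) (u : ZMod p) (hu : u ^ q = 1) (hu1 : u ≠ 1) :
    ∃ (g : H) (v : ZMod p), g ≠ 1 ∧ g ^ p = 1 ∧ v ^ q = 1 ∧ v ≠ 1 ∧ y * g * y⁻¹ = g ^ v.val := by
  classical
  haveI : Fact p.Prime := ⟨hp⟩
  haveI : Fact q.Prime := ⟨hq⟩
  obtain ⟨ha1, hap, hcomm, hyq, htr⟩ := h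
  let c' : ℕ → H := fun i => y ^ i * a * (y ^ i)⁻¹
  set W : Subgroup H := Subgroup.closure (Set.range c') with hWdef
  have hSc : ∀ x ∈ Set.range c', ∀ z ∈ Set.range c', x * z = z * x := by
    rintro x ⟨i, rfl⟩ z ⟨j, rfl⟩; exact (hcomm i j).eq
  letI : CommGroup W :=
    { (inferInstance : Group W) with mul_comm := (Subgroup.isMulCommutative_closure hSc).is_comm.comm }
  have hc'mem : ∀ i, c' i ∈ W := fun i => Subgroup.subset_closure ⟨i, rfl⟩
  have hc'succ : ∀ i, y * c' i * y⁻¹ = c' (i + 1) := by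
    intro i; change y * (y ^ i * a * (y ^ i)⁻¹) * y⁻¹ = y ^ (i + 1) * a * (y ^ (i + 1))⁻¹
    rw [pow_succ']; group
  -- `y` normalises `W`
  have hyW : ∀ x ∈ W, y * x * y⁻¹ ∈ W := by
    intro x hx
    have hmap : W.map (MulAut.conj y).toMonoidHom ≤ W := by
      rw [hWdef, MonoidHom.map_closure]
      refine Subgroup.closure_le _ |>.2 ?_
      rintro _ ⟨_, ⟨i, rfl⟩, rfl⟩
      change y * c' i * y⁻¹ ∈ Subgroup.closure (Set.range c')
      rw [hc'succ]
      exact Subgroup.subset_closure ⟨i + 1, rfl⟩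
    exact hmap ⟨x, hx, rfl⟩
  let φ : W →* W := ((MulAut.conj y).toMonoidHom.comp W.subtype).codRestrict W (fun x => hyW x x.2)
  have hφ_coe : ∀ x : W, ((φ x : W) : H) = y * x * y⁻¹ := fun x => rfl
  let c : ℕ → W := fun i => ⟨c' i, hc'mem i⟩
  have hcq' : ∀ i, c (i + q) = c i := by
    intro i; apply Subtype.ext
    change y ^ (i + q) * a * (y ^ (i + q))⁻¹ = y ^ i * a * (y ^ i)⁻¹
    rw [pow_add, mul_inv_rev, show y ^ i * y ^ q * a * ((y ^ q)⁻¹ * (y ^ i)⁻¹) =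
      y ^ i * (y ^ q * a * (y ^ q)⁻¹) * (y ^ i)⁻¹ by group, hyq]
  have hcp' : ∀ i, c i ^ p = 1 := by
    intro i; apply Subtype.ext
    change (y ^ i * a * (y ^ i)⁻¹) ^ p = 1
    rw [← MulAut.conj_apply, ← map_pow, hap, map_one]
  have hφc : ∀ i, φ (c i) = c (i + 1) := fun i => Subtype.ext (hc'succ i)
  have h0 : c 0 ≠ 1 := by
    intro h
    have := congrArg Subtype.val h
    change y ^ 0 * a * (y ^ 0)⁻¹ = 1 at this
    rw [pow_zero, one_mul, inv_one, mul_one] at this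
    exact ha1 this
  have hprod : ∀ n, ((∏ i ∈ range n, c i : W) : H) = conjTrace y a n := by
    intro n
    induction n with
    | zero => simp
    | succ n ih => rw [prod_range_succ, Subgroup.coe_mul, ih, conjTrace_succ']
  have htr' : ∏ i ∈ range q, c i = 1 := Subtype.ext (by rw [hprod, htr]; rfl)
  obtain ⟨g, v, hg1, hgp, hvq, hv1, hφg⟩ := DFT.exists_eigen hpq c hcq' hcp' φ hφc u hu hu1 h0 htr'
  refine ⟨g, v, fun e => hg1 (Subtype.ext e), ?_, hvq, hv1, ?_⟩
  · have := congrArg Subtype.val hgp; simpa using this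
  · rw [← hφ_coe, hφg, Subgroup.coe_pow]

/-- **`AtomBad p q` from the Frobenius models when `p ≡ 1 (mod q)`.**  For primes `p ≠ q` and a non-trivial `q`-th root of
unity `u` mod `p`: if `ℤ/p ⋊_v ℤ/q` (`MetaCyc p q v`) is box-useless for every non-trivial `q`-th root of unity `v` mod `p`, then
every finite group with an `A(p,q)`-configuration is box-useless. [folklore] -/
theorem atomBad_of_frobenius_models {p q : ℕ} [Fact p.Prime] [Fact q.Prime] (hpq : p ≠ q) (u : ZMod p) (hu : u ^ q = 1)
    (hu1 : u ≠ 1) (hbad : ∀ (v : ZMod p) [Fact (v ^ q = 1)], v ≠ 1 → ¬ BoxUseful (MetaCyc p q v)) :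
    AtomBad.{u} p q := by
  intro H _ _ _ a y h
  have hp : p.Prime := Fact.out
  have hq : q.Prime := Fact.out
  obtain ⟨g, v, hg1, hgp, hvq, hv1, hyg⟩ := h.exists_frobenius hp hq hpq u hu hu1
  haveI : Fact (v ^ q = 1) := ⟨hvq⟩
  exact not_boxUseful_of_frobenius (orderOf_eq_prime hgp hg1) v hv1 hyg (hbad v hv1)

end Summit.MatrixMultiplication.OmegaCensus
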